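import Mathlib.Topology.Sequences
import Literature.AnabelianGeometry.SemiGraphs.SubgroupPresentationStabilizers
import Literature.AnabelianGeometry.SemiGraphs.TemperedBranchPairProfinite
import Literature.AnabelianGeometry.SemiGraphs.ArithLevelCofinalityOuterAction
import HarnessLib

/-!
# [SemiAnbd] Thm 5.4 (i) p. 66, producer T54-B: the residual «hUρ» of the hcof-free route FOLLOWS from
# [SemiAnbd] Prop 3.6 (iii) (residual finiteness of `π₁^temp` along the finite levels) — generic tower form

Mochizuki, *Semi-graphs of anabelioids*, Publ. RIMS **42** (2006), §3 Prop 3.6 (iii) p. 38 ("an injection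
`π₁^temp(G) ↪ π̂₁(G)`"), Thm 3.7 (iii) p. 41, §5 Def 5.1 (i) p. 62, Thm 5.4 (i) p. 66
[cite: MochizukiSemiAnbd2006, Thm 5.4 (i) p.66].

PROOF-ONLY (abc-iut cell, row T54-B, gap row G-w4d085-1; seat abc-iut-w4-d085 gen 4).  The hcof-free
(AI4″) producer `map_aug_le_conj_of_levelDict_modKernel` (ArithBranchPairAugModKernel.lean) leaves at the
outer model the residual «hUρ»: every `a ∈ U_∞ := ⋂ₙ aug (ker (arithAct (L n)))` acts on `Γ = π₁^temp(𝒢)`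
by an INNER automorphism.  THIS FILE PROVES IT from tower data alone (pure group theory / topology over a
subgroup presentation `P`; no definition, no named fact):

* `deckAct_faithful_levels_of_forall_notMem` (Lemma A/B): if `Γ` is RESIDUALLY FINITE ALONG THE FINITE
  LEVELS (`hR : ∀ g ≠ 1, ∃ n, g ∉ L n` — [SemiAnbd] Prop 3.6 (iii) at a tower cofinal among the open
  normal subgroups of finite index), the vertex groups are compact and some compact subgroup test
  `hnobp` kills the compact subgroups acting trivially on every finite level (the `hnobpN` shape at any
  one compatible branch-pair system), then `Γ` acts FAITHFULLY on the tower of finite coset levels: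
  `(∀ n, deckAct (L n) t = 1) → t = 1`;
* `exists_lift_arithAct_eq_one_of_mem_iInf_map_ker` (Theorem C): for an arithmetic group `E ⊇ ι(Γ)` with
  `ker aug = ι(Γ)` acting compatibly (`IsArithCompatible`) on the coset tower, TREE levels `K m` with the
  algebraic tower inputs `hHK`/`hlift` (abc-iut-w4-d059 dict2 / abc-iut-w4-d085 (P-K)) below the finite
  levels `L n ⊇ K n` (open, antitone), `Γ` first countable: every `a ∈ U_∞` has a lift `e′` with
  `arithAct (L n) e′ = 1` for ALL `n` — ONE lift, not one per level.  (The level-`n` lifts of `a` are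
  `e·ι(gₙ)`, so `e` acts at level `n` as the deck transformation `dₙ`; the TREE-level system `e·ω̃` is
  `(H_{v₀} y K_m)_m` for one `y` (`exists_rep_and_stabilizer_of_compatible`), which confines the `dₙ` to the
  COMPACT set `y⁻¹ H_{v₀}` modulo the trivially-acting `L n`; a convergent subsequence `d_{n_k} → d` and
  local constancy of the deck actions give `arithAct (L n) e = deckAct (L n) d` for all `n`.)
* `map_eq_one_of_forall_arithAct_eq_one` (Theorem C′): such a lift has `Φ e′ = 1` (and `σ e′ = 1`) as soon
  as `Γ` acts faithfully on the finite levels: `ι (Φ e′ y) = e′ ι(y) e′⁻¹` acts like `ι y` at every level.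
* `mem_ker_of_mem_iInf_map_ker_arithAct_outerAction` (Corollary D, the outer model
  `E := π₁^temp(𝒢) ⋊^out Π_A`): «hUρ» — `U_∞ ≤ ker ρ` — from the inputs above; with
  `iInf_map_ker_le_of_le_ker_rho` (ArithLevelKernelBaseAction.lean) this is «hU-arith», the ONLY residual
  of the hcof-free route, now a theorem modulo [SemiAnbd] Prop 3.6 (iii) in the form `hR`.

Nothing here refers to the IUT corpus beyond the producer row it serves; no side is taken on [IUTchIII]
Cor 3.12; typed ≠ proved for inputs left as binders.
-/

namespace Literature.AnabelianGeometry.SemiGraphs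

open CategoryTheory Topology Filter
open scoped Pointwise

universe u v w

namespace SemiGraph

namespace SubgroupPresentation

variable {𝔾 : SemiGraph.{u}} {Γ : Type u} [Group Γ] [TopologicalSpace Γ] [IsTopologicalGroup Γ]
  (P : SubgroupPresentation 𝔾 Γ)

/-! ### Lemma A/B: faithfulness of `Γ` on the finite levels from residual finiteness -/

section Faithful

variable (L : ℕ → Subgroup Γ) [∀ n, (L n).Normal]

omit [TopologicalSpace Γ] [IsTopologicalGroup Γ] in
/-- An element acting trivially on the level-`L` coset semi-graph lies in `z⁻¹ H_w z · L` for every vertex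
`w` and every `z` (it fixes the vertex `H_w z L`). [cite: MochizukiSemiAnbd2006, Thm 3.7 (iii) p.41] -/
theorem mem_conj_mul_of_deckAct_eq_one (Lv : Subgroup Γ) [Lv.Normal] {t : Γ} (ht : P.deckAct Lv t = 1)
    (w : 𝔾.Vertex) (z : Γ) :
    t ∈ (((P.H w).map (MulAut.conj z⁻¹).toMonoidHom : Subgroup Γ) : Set Γ) * (Lv : Set Γ) := by
  have hfix : (P.deckAct Lv t).hom.vertexMap (P.vMk Lv w z) = P.vMk Lv w z := by rw [ht]; rfl
  rw [P.deckAct_vertexMap_vMk] at hfix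
  have hmk : DoubleCoset.mk (P.H w) Lv (z * t⁻¹) = DoubleCoset.mk (P.H w) Lv z :=
    eq_of_heq (Sigma.mk.inj_iff.mp hfix).2
  obtain ⟨h, hh, l, hl, hzl⟩ := (DoubleCoset.eq _ _ _ _).mp hmk
  -- `z = h * (z * t⁻¹) * l`, so `t = l * z⁻¹ * h * z = (z⁻¹ h z) * ((z⁻¹ h z)⁻¹ * l * (z⁻¹ h z))`
  have hzt : z * t⁻¹ = h⁻¹ * z * l⁻¹ := by
    calc z * t⁻¹ = h⁻¹ * (h * (z * t⁻¹) * l) * l⁻¹ := by group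
      _ = h⁻¹ * z * l⁻¹ := by rw [← hzl]
  have ht' : t = l * (z⁻¹ * h * z) := by
    calc t = (z * t⁻¹)⁻¹ * z := by group
      _ = (h⁻¹ * z * l⁻¹)⁻¹ * z := by rw [hzt]
      _ = l * (z⁻¹ * h * z) := by group
  refine Set.mem_mul.mpr ⟨z⁻¹ * h * z, ⟨h, hh, by simp⟩,
    (z⁻¹ * h * z)⁻¹ * l * (z⁻¹ * h * z), Subgroup.Normal.conj_mem' inferInstance l hl _, ?_⟩
  rw [ht']; group

/-- **Lemma A.** If `Γ` is residually finite along the open antitone finite levels `L n` (`hR`) and the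
vertex groups are compact, an element acting trivially on EVERY finite coset level lies in every conjugate
of every vertex group (`⋂ₙ (z⁻¹H_w z)·L n = z⁻¹H_w z`, abc-iut-L3-t11's `iInter_mul_coe_eq_of_isCompact`).
[cite: MochizukiSemiAnbd2006, Prop 3.6 (iii) p.38] -/
theorem mem_conj_of_forall_deckAct_eq_one [T2Space Γ] (hLopen : ∀ n, IsOpen (L n : Set Γ))
    (hLanti : Antitone L) (hR : ∀ g : Γ, (∀ n, g ∈ L n) → g = 1)
    (hHc : ∀ w, IsCompact (P.H w : Set Γ)) {t : Γ} (ht : ∀ n, P.deckAct (L n) t = 1)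
    (w : 𝔾.Vertex) (z : Γ) : z * t * z⁻¹ ∈ P.H w := by
  have hWc : IsCompact (((P.H w).map (MulAut.conj z⁻¹).toMonoidHom : Subgroup Γ) : Set Γ) := by
    have hc : Continuous (fun x : Γ => (MulAut.conj z⁻¹) x) := by
      simp only [MulAut.conj_apply]
      exact (continuous_const.mul continuous_id).mul continuous_const
    rw [Subgroup.coe_map, MulEquiv.coe_toMonoidHom]
    exact (hHc w).image hc
  have hdir : ∀ i j : ℕ, ∃ k, L k ≤ L i ∧ L k ≤ L j :=
    fun i j => ⟨max i j, hLanti (le_max_left i j), hLanti (le_max_right i j)⟩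
  have key := iInter_mul_coe_eq_of_isCompact L hLopen hdir hR hWc
  have hmem : t ∈ ⋂ n, (((P.H w).map (MulAut.conj z⁻¹).toMonoidHom : Subgroup Γ) : Set Γ) * (L n : Set Γ) :=
    Set.mem_iInter.mpr fun n => P.mem_conj_mul_of_deckAct_eq_one (L n) (ht n) w z
  rw [key] at hmem
  obtain ⟨h, hh, hht⟩ := hmem
  rw [← hht, MulEquiv.coe_toMonoidHom, MulAut.conj_apply]
  have : z * (z⁻¹ * h * z⁻¹⁻¹) * z⁻¹ = h := by group
  rw [this]
  exact hh

/-- **Lemma B: `Γ` acts faithfully on the tower of finite coset levels** — from residual finiteness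
(`hR`, [SemiAnbd] Prop 3.6 (iii)), compact vertex groups, and ONE compact-subgroup test `hnobp` killing
every compact subgroup of `Γ` that acts trivially on all finite levels (the shape produced by the
estrangement input `hnobpN` at any compatible branch-pair system). [cite: MochizukiSemiAnbd2006, Thm 3.7 (iii) p.41] -/
theorem deckAct_faithful_levels_of_forall_notMem [T2Space Γ] (hLopen : ∀ n, IsOpen (L n : Set Γ))
    (hLanti : Antitone L) (hR : ∀ g : Γ, (∀ n, g ∈ L n) → g = 1)
    (hHc : ∀ w, IsCompact (P.H w : Set Γ)) (w₀ : 𝔾.Vertex)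
    (hnobp : ∀ C : Subgroup Γ, IsCompact (C : Set Γ) → (∀ n (t : C), P.deckAct (L n) (t : Γ) = 1) → C = ⊥)
    {t : Γ} (ht : ∀ n, P.deckAct (L n) t = 1) : t = 1 := by
  -- the joint kernel `D_∞` is a closed subgroup of the compact `H_{w₀}`
  let D : Subgroup Γ := ⨅ n, (P.deckAct (L n)).ker
  have hDle : (D : Set Γ) ⊆ P.H w₀ := by
    intro s hs
    have hs' : ∀ n, P.deckAct (L n) s = 1 := fun n =>
      (MonoidHom.mem_ker).mp (Subgroup.mem_iInf.mp hs n)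
    simpa using P.mem_conj_of_forall_deckAct_eq_one L hLopen hLanti hR hHc hs' w₀ 1
  have hDclosed : IsClosed (D : Set Γ) := by
    have : (D : Set Γ) = ⋂ n, ((P.deckAct (L n)).ker : Set Γ) := by
      simp only [D, Subgroup.coe_iInf]
    rw [this]
    refine isClosed_iInter fun n => ?_
    refine Subgroup.isClosed_of_isOpen _ (Subgroup.isOpen_mono ?_ (hLopen n))
    intro g hg
    exact (MonoidHom.mem_ker).mpr (P.deckAct_eq_one_of_mem (L n) hg)
  have hDc : IsCompact (D : Set Γ) := (hHc w₀).of_isClosed_subset hDclosed hDle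
  have hD : D = ⊥ := hnobp D hDc fun n s =>
    (MonoidHom.mem_ker).mp (Subgroup.mem_iInf.mp s.2 n)
  have htD : t ∈ D := Subgroup.mem_iInf.mpr fun n => (MonoidHom.mem_ker).mpr (ht n)
  rw [hD] at htD
  exact (Subgroup.mem_bot).mp htD

end Faithful

/-! ### Theorem C: one lift acting trivially at every finite level -/

section Lift

variable {E : Type v} [Group E] {Φ : E →* MulAut Γ} {σ : E →* Aut 𝔾} (hP : P.IsArithCompatible Φ σ)
  (ι : Γ →* E) (hιΦ : ∀ g : Γ, Φ (ι g) = MulAut.conj g) (hισ : ∀ g : Γ, σ (ι g) = 1)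
  {PA : Type w} [Group PA] (aug : E →* PA)
  (hex : ∀ e e' : E, aug e = aug e' → ∃ g : Γ, e' = e * ι g) (haugι : ∀ g : Γ, aug (ι g) = 1)
  -- tree levels
  (K : ℕ → Subgroup Γ) [∀ m, (K m).Normal] (hK : ∀ ⦃i j : ℕ⦄, i ≤ j → K j ≤ K i)
  (hKst : ∀ (m : ℕ) (e : E) (x : Γ), x ∈ K m → Φ e x ∈ K m)
  (hHK : ∀ (w : 𝔾.Vertex) (x : Γ), (∀ j, x ∈ (P.H w : Set Γ) * (K j : Set Γ)) → x ∈ P.H w)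
  (hlift : ∀ (w : 𝔾.Vertex) (y : ℕ → Γ),
    (∀ ⦃i j : ℕ⦄, i ≤ j → DoubleCoset.mk (P.H w) (K i) (y j) = DoubleCoset.mk (P.H w) (K i) (y i)) →
    ∃ z : Γ, ∀ j, DoubleCoset.mk (P.H w) (K j) z = DoubleCoset.mk (P.H w) (K j) (y j))
  -- finite levels
  (L : ℕ → Subgroup Γ) [∀ n, (L n).Normal]
  (hLst : ∀ (n : ℕ) (e : E) (x : Γ), x ∈ L n → Φ e x ∈ L n)
  (hKL : ∀ n, K n ≤ L n) (hLopen : ∀ n, IsOpen (L n : Set Γ)) (hLanti : Antitone L)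
  (v₀ : 𝔾.Vertex) (hHc : IsCompact (P.H v₀ : Set Γ))

include hιΦ hισ hex haugι hK hKst hHK hlift hKL hLopen hLanti hHc

/-- **Theorem C.** Every `a ∈ U_∞ = ⋂ₙ aug (ker (arithAct (L n)))` admits ONE lift `e′ ∈ E` acting
trivially on EVERY finite coset level (see the module docstring for the compactness argument).
[cite: MochizukiSemiAnbd2006, Thm 5.4 (i) p.66] -/
theorem exists_lift_arithAct_eq_one_of_mem_iInf_map_ker [FirstCountableTopology Γ] {a : PA}
    (ha : ∀ n, a ∈ ((P.arithAct hP (L n) (hLst n)).ker).map aug) :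
    ∃ e' : E, aug e' = a ∧ ∀ n, P.arithAct hP (L n) (hLst n) e' = 1 := by
  classical
  -- a lift `e` of `a`
  obtain ⟨e, -, hea⟩ := ha 0
  -- at each level, `e` acts as a deck transformation
  have hdeck : ∀ n, ∃ d : Γ, P.arithAct hP (L n) (hLst n) e = P.deckAct (L n) d := by
    intro n
    obtain ⟨k, hk, hka⟩ := ha n
    obtain ⟨g, rfl⟩ := hex e k (by rw [hea, hka])
    refine ⟨g⁻¹, ?_⟩
    have h1 : P.arithAct hP (L n) (hLst n) (e * ι g) = 1 := (MonoidHom.mem_ker).mp hk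
    rw [map_mul, P.arithAct_eq_deckAct_of_inner hP (L n) (hLst n) (hιΦ g) (hισ g),
      mul_eq_one_iff_eq_inv, ← map_inv] at h1
    exact h1
  -- the TREE-level system `e · ω̃` is `(H_{v₀} y K_m)_m` for one `y` (its base vertex is `v₀`: `σ e = 1`)
  let x : ∀ m, (P.cosetGraph (K m)).Vertex := fun m =>
    (P.arithAct hP (K m) (hKst m) e).hom.vertexMap (P.vMk (K m) v₀ 1)
  have hx : ∀ ⦃i j : ℕ⦄ (h : i ≤ j), (P.cosetGraphTrans (hK h)).vertexMap (x j) = x i := by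
    intro i j h
    have := congrArg (fun f : P.cosetGraph (K j) ⟶ P.cosetGraph (K i) => f.vertexMap (P.vMk (K j) v₀ 1))
      (P.arithAct_trans hP (hKst j) (hKst i) (hK h) e)
    exact this
  obtain ⟨w, y, hxy, -⟩ := P.exists_rep_and_stabilizer_of_compatible K hK hHK hlift x hx
  -- pushed to the finite levels: `e · ω_n = H_w y L_n`, while `e · ω_n = deckAct d_n · ω_n = H_{v₀} d_n⁻¹ L_n`
  have hfin : ∀ n (d : Γ), P.arithAct hP (L n) (hLst n) e = P.deckAct (L n) d →
      P.vMk (L n) v₀ (1 * d⁻¹) = P.vMk (L n) w y := by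
    intro n d hd
    have htr := congrArg (fun f : P.cosetGraph (K n) ⟶ P.cosetGraph (L n) => f.vertexMap (P.vMk (K n) v₀ 1))
      (P.arithAct_trans hP (hKst n) (hLst n) (hKL n) e)
    -- `htr : trans (x n) = arithAct (L n) e (vMk v₀ 1)`
    change (P.cosetGraphTrans (hKL n)).vertexMap (x n) =
      (P.arithAct hP (L n) (hLst n) e).hom.vertexMap (P.vMk (L n) v₀ 1) at htr
    rw [hxy n, hd, P.deckAct_vertexMap_vMk] at htr
    exact htr.symm
  -- hence `d_n ∈ L_n · y⁻¹ · H_{v₀}`-translate: WLOG `d_n ∈ C := {y⁻¹ * h | h ∈ H_{v₀}}` (and `w = v₀`)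
  have hdeckC : ∀ n, ∃ d : Γ, d ∈ (fun h : Γ => y⁻¹ * h) '' (P.H v₀ : Set Γ) ∧
      P.arithAct hP (L n) (hLst n) e = P.deckAct (L n) d := by
    intro n
    obtain ⟨d, hd⟩ := hdeck n
    have hv := hfin n d hd
    have hw : v₀ = w := congrArg Sigma.fst hv
    subst hw
    have hmk : DoubleCoset.mk (P.H v₀) (L n) (1 * d⁻¹) = DoubleCoset.mk (P.H v₀) (L n) y :=
      eq_of_heq (Sigma.mk.inj_iff.mp hv).2
    obtain ⟨h, hh, l, hl, hyl⟩ := (DoubleCoset.eq _ _ _ _).mp hmk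
    -- `y = h * d⁻¹ * l`, so `d = l * y⁻¹ * h = (y⁻¹ h) * ((y⁻¹ h)⁻¹ l (y⁻¹ h))`
    refine ⟨y⁻¹ * h, ⟨h, hh, rfl⟩, ?_⟩
    have hd' : d = (y⁻¹ * h) * ((y⁻¹ * h)⁻¹ * l * (y⁻¹ * h)) := by
      have : y = h * (1 * d⁻¹) * l := hyl
      calc d = l * (h * (1 * d⁻¹) * l)⁻¹ * h := by group
        _ = l * y⁻¹ * h := by rw [← this]
        _ = (y⁻¹ * h) * ((y⁻¹ * h)⁻¹ * l * (y⁻¹ * h)) := by group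
    have hlmem : (y⁻¹ * h)⁻¹ * l * (y⁻¹ * h) ∈ L n := Subgroup.Normal.conj_mem' inferInstance l hl _
    rw [hd, hd', map_mul, P.deckAct_eq_one_of_mem (L n) hlmem, mul_one]
  choose d hdC hd using hdeckC
  -- a convergent subsequence in the compact set `y⁻¹ H_{v₀}`
  have hCc : IsCompact ((fun h : Γ => y⁻¹ * h) '' (P.H v₀ : Set Γ)) :=
    hHc.image (continuous_const.mul continuous_id)
  obtain ⟨d₀, -, φ, hφ, hlim⟩ := hCc.tendsto_subseq hdC
  -- `deckAct (L m) d₀ = arithAct (L m) e` for every `m`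
  have hall : ∀ m, P.arithAct hP (L m) (hLst m) e = P.deckAct (L m) d₀ := by
    intro m
    -- eventually `d (φ k) * d₀⁻¹ ∈ L m`
    have hev : ∀ᶠ k in atTop, d (φ k) * d₀⁻¹ ∈ (L m : Set Γ) := by
      have hcont : Tendsto (fun k => d (φ k) * d₀⁻¹) atTop (𝓝 (d₀ * d₀⁻¹)) :=
        hlim.mul tendsto_const_nhds
      rw [mul_inv_cancel] at hcont
      exact hcont (IsOpen.mem_nhds (hLopen m) (L m).one_mem)
    obtain ⟨k, hk⟩ := (hev.and (eventually_ge_atTop m)).exists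
    obtain ⟨hkL, hkm⟩ := hk
    have hkm' : m ≤ φ k := hkm.trans (StrictMono.id_le hφ k)
    -- at level `φ k`: `e · ι(d (φ k))⁻¹` acts trivially, hence also at the coarser level `m`
    have htriv : P.arithAct hP (L m) (hLst m) (e * ι (d (φ k))⁻¹) = 1 := by
      have h1 : e * ι (d (φ k))⁻¹ ∈ (P.arithAct hP (L (φ k)) (hLst (φ k))).ker := by
        rw [MonoidHom.mem_ker, map_mul, hd (φ k),
          P.arithAct_eq_deckAct_of_inner hP (L (φ k)) (hLst (φ k)) (hιΦ (d (φ k))⁻¹) (hισ _),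
          ← map_mul, mul_inv_cancel, map_one]
      exact (MonoidHom.mem_ker).mp (P.ker_arithAct_anti hP (hLst (φ k)) (hLst m) (hLanti hkm') h1)
    rw [map_mul, P.arithAct_eq_deckAct_of_inner hP (L m) (hLst m) (hιΦ (d (φ k))⁻¹) (hισ _), map_inv,
      mul_inv_eq_one] at htriv
    -- `deckAct (L m) (d (φ k)) = deckAct (L m) d₀`
    rw [htriv, show d (φ k) = (d (φ k) * d₀⁻¹) * d₀ by group, map_mul,
      P.deckAct_eq_one_of_mem (L m) hkL, one_mul]
  -- the lift
  refine ⟨e * ι d₀⁻¹, by rw [map_mul, haugι, mul_one, hea], fun n => ?_⟩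
  rw [map_mul, hall n, P.arithAct_eq_deckAct_of_inner hP (L n) (hLst n) (hιΦ _) (hισ _), ← map_mul,
    mul_inv_cancel, map_one]

omit [TopologicalSpace Γ] [IsTopologicalGroup Γ] hex haugι hK hKst hHK hlift hKL hLopen hLanti hHc in
/-- **Theorem C′.** A lift acting trivially on EVERY finite level acts on `Γ` by the IDENTITY, provided
`ι` realises `Φ` by conjugation (`hconj`) and `Γ` acts faithfully on the finite levels (`hfaithL`,
Lemma B): `ι (Φ e y)` acts like `e ι(y) e⁻¹`, i.e. like `ι y`, at every level.
[cite: MochizukiSemiAnbd2006, Thm 5.4 (i) p.66] -/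
theorem map_eq_one_of_forall_arithAct_eq_one
    (hconj : ∀ (e : E) (y : Γ), e * ι y * e⁻¹ = ι (Φ e y))
    (hfaithL : ∀ t : Γ, (∀ n, P.deckAct (L n) t = 1) → t = 1)
    {e : E} (he : ∀ n, P.arithAct hP (L n) (hLst n) e = 1) : Φ e = 1 := by
  ext y
  change Φ e y = y
  have key : ∀ n, P.deckAct (L n) (Φ e y * y⁻¹) = 1 := by
    intro n
    have h1 : P.arithAct hP (L n) (hLst n) (ι (Φ e y)) = P.arithAct hP (L n) (hLst n) (ι y) := by
      rw [← hconj, map_mul, map_mul, he n, one_mul, map_inv, he n, inv_one, mul_one]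
    rw [P.arithAct_eq_deckAct_of_inner hP (L n) (hLst n) (hιΦ _) (hισ _),
      P.arithAct_eq_deckAct_of_inner hP (L n) (hLst n) (hιΦ _) (hισ _)] at h1
    rw [map_mul, map_inv, h1, mul_inv_cancel]
  exact mul_inv_eq_one.mp (hfaithL _ key)

end Lift

end SubgroupPresentation

end SemiGraph

/-! ### Corollary D: «hUρ» at the outer model `π₁^temp(𝒢) ⋊^out Π_A` -/

namespace ProfiniteSemiGraph

open Literature.AnabelianGeometry.EtaleTheta

variable {𝒢 : ProfiniteSemiGraph.{u}} (c : TemperedPiChart 𝒢)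
  {PA : Type u} [Group PA] (ρ : PA →* TopOut c.G) (baseAct : PA →* Aut 𝒢.graph)
  (P : SemiGraph.SubgroupPresentation 𝒢.graph c.G)
  (hP : P.IsArithCompatible
    (((contMulAut c.G).subtype.comp (MonoidHom.fst (contMulAut c.G) PA)).comp
      (outerSemidirectProduct ρ).subtype)
    (baseAct.comp (outerSemidirectProductSnd ρ)))

/-- **Corollary D: «hUρ» at the outer model** — `U_∞ := ⋂ₙ aug (ker (arithAct (L n))) ≤ ker ρ` — from:
exactness of `1 → π₁^temp(𝒢) → E → Π_A` (`hex`: `ker aug = ι(π₁^temp 𝒢)`, abc-iut-L3-d2/w4-d082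
`outerAction_exact`), TREE levels `K m` with the dict2/(P-K) tower inputs `hHK`/`hlift`, open antitone
finite levels `L n ⊇ K n`, a compact vertex group `H_{v₀}`, `π₁^temp(𝒢)` first countable and Hausdorff,
RESIDUAL FINITENESS along the finite levels (`hR`, [SemiAnbd] Prop 3.6 (iii)) and the compact-subgroup
test `hnobp` (estrangement).  An element of `Π_A` admitting at every finite level a lift acting trivially
on that level's coset semi-graph acts on `π₁^temp(𝒢)` by an INNER automorphism.
[cite: MochizukiSemiAnbd2006, Thm 5.4 (i) p.66] -/
theorem mem_ker_of_mem_iInf_map_ker_arithAct_outerAction [IsTopologicalGroup c.G] [T2Space c.G]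
    [FirstCountableTopology c.G]
    (hex : (toOuterSemidirectProduct ρ).range = (outerSemidirectProductSnd ρ).ker)
    (K : ℕ → Subgroup c.G) [∀ m, (K m).Normal] (hK : ∀ ⦃i j : ℕ⦄, i ≤ j → K j ≤ K i)
    (hKst : ∀ (m : ℕ) (e : outerSemidirectProduct ρ) (x : c.G), x ∈ K m →
      (((contMulAut c.G).subtype.comp (MonoidHom.fst (contMulAut c.G) PA)).comp
        (outerSemidirectProduct ρ).subtype) e x ∈ K m)
    (hHK : ∀ (w : 𝒢.graph.Vertex) (x : c.G), (∀ j, x ∈ (P.H w : Set c.G) * (K j : Set c.G)) → x ∈ P.H w)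
    (hlift : ∀ (w : 𝒢.graph.Vertex) (y : ℕ → c.G),
      (∀ ⦃i j : ℕ⦄, i ≤ j → DoubleCoset.mk (P.H w) (K i) (y j) = DoubleCoset.mk (P.H w) (K i) (y i)) →
      ∃ z : c.G, ∀ j, DoubleCoset.mk (P.H w) (K j) z = DoubleCoset.mk (P.H w) (K j) (y j))
    (L : ℕ → Subgroup c.G) [∀ n, (L n).Normal]
    (hLst : ∀ (n : ℕ) (e : outerSemidirectProduct ρ) (x : c.G), x ∈ L n →
      (((contMulAut c.G).subtype.comp (MonoidHom.fst (contMulAut c.G) PA)).comp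
        (outerSemidirectProduct ρ).subtype) e x ∈ L n)
    (hKL : ∀ n, K n ≤ L n) (hLopen : ∀ n, IsOpen (L n : Set c.G)) (hLanti : Antitone L)
    (v₀ : 𝒢.graph.Vertex) (hHc : ∀ w, IsCompact (P.H w : Set c.G))
    (hR : ∀ g : c.G, (∀ n, g ∈ L n) → g = 1)
    (hnobp : ∀ C : Subgroup c.G, IsCompact (C : Set c.G) →
      (∀ n (t : C), P.deckAct (L n) (t : c.G) = 1) → C = ⊥)
    {a : PA} (ha : ∀ n, a ∈ ((P.arithAct hP (L n) (hLst n)).ker).map (outerSemidirectProductSnd ρ)) :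
    a ∈ ρ.ker := by
  have hιΦ : ∀ g : c.G, (((contMulAut c.G).subtype.comp (MonoidHom.fst (contMulAut c.G) PA)).comp
      (outerSemidirectProduct ρ).subtype) (toOuterSemidirectProduct ρ g) = MulAut.conj g := fun _ => rfl
  have hισ : ∀ g : c.G, (baseAct.comp (outerSemidirectProductSnd ρ)) (toOuterSemidirectProduct ρ g) = 1 :=
    fun g => by
      have hg : toOuterSemidirectProduct ρ g ∈ (outerSemidirectProductSnd ρ).ker := hex ▸ ⟨g, rfl⟩
      rw [MonoidHom.comp_apply, (MonoidHom.mem_ker).mp hg, map_one]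
  have haugι : ∀ g : c.G, outerSemidirectProductSnd ρ (toOuterSemidirectProduct ρ g) = 1 := fun g =>
    (MonoidHom.mem_ker).mp (hex ▸ ⟨g, rfl⟩)
  have hex' : ∀ e e' : outerSemidirectProduct ρ, outerSemidirectProductSnd ρ e = outerSemidirectProductSnd ρ e' →
      ∃ g : c.G, e' = e * toOuterSemidirectProduct ρ g := by
    intro e e' h
    have hmem : e⁻¹ * e' ∈ (outerSemidirectProductSnd ρ).ker := by
      rw [MonoidHom.mem_ker, map_mul, map_inv, h, inv_mul_cancel]
    rw [← hex] at hmem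
    obtain ⟨g, hg⟩ := hmem
    exact ⟨g, by rw [hg, mul_inv_cancel_left]⟩
  obtain ⟨e', he'a, he'⟩ := P.exists_lift_arithAct_eq_one_of_mem_iInf_map_ker hP
    (toOuterSemidirectProduct ρ) hιΦ hισ (outerSemidirectProductSnd ρ) hex' haugι K hK hKst hHK hlift L
    hLst hKL hLopen hLanti v₀ (hHc v₀) ha
  have hΦ := P.map_eq_one_of_forall_arithAct_eq_one hP (toOuterSemidirectProduct ρ) hιΦ hισ L hLst
    (fun e y => conj_toOuterSemidirectProduct ρ e y)
    (fun t ht => P.deckAct_faithful_levels_of_forall_notMem L hLopen hLanti hR hHc v₀ hnobp ht) he'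
  -- `Φ e' = 1` means the `Aut`-component of `e'` is `1`; membership in `G ⋊^out J` gives `ρ a = [1] = 1`
  have h1 : (e'.1.1 : MulAut c.G) = 1 := hΦ
  have hmem : TopOut.mk c.G e'.1.1 = ρ e'.1.2 := e'.2
  have h1' : e'.1.1 = 1 := Subtype.ext h1
  rw [h1', map_one] at hmem
  rw [MonoidHom.mem_ker, ← he'a]
  exact hmem.symm

end ProfiniteSemiGraph

end Literature.AnabelianGeometry.SemiGraphs
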